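import Summits.Ventures.CertifiedManyBodySolver.Observables.PhaseSeparationExclusionBoxGrandCanonical
import HarnessLib

/-!
# Ventures/CertifiedManyBodySolver — Observables/PhaseSeparationExclusionBoxGrandCanonicalThermalGap.lean: the competing-orders word on
# a `(t′, U)` CELL of a material box at `T > 0`, read on the chemical-potential axis as a CELL-UNIFORM CERTIFIED GAP `Δμ ≥ g/(ab(n₂ − n₁))`
# for every `β ≥ β₀` (hot anchors, threshold form; fns / columns / above-column)

HONEST FRAMING: first certified bounds; not a superconductivity verdict. CLASS = TRANSPORT (generic, sorry-free theorems; no claim node,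
no number): the `T > 0` GAP companion of `PhaseSeparationExclusionBoxGrandCanonical` (whose §2 typed only the one-`μ` EXCLUSION at `T > 0`).
Inputs are IDENTICAL to the canonical hot-anchor cell forms (`PhaseSeparationExclusionBoxThermalHotAnchor`): a cap affine in `U` at
`an₁ + bn₂`, two column laws at `n₂` (their `U`-chord floors the cell), a dilute floor function at `n₁`, cell-uniform pressure anchors
`p(β_{h,i}; n_i) ≤ π_i` at `β_{h,i} ≤ β₀`; the two extra checks per column are `g ≤ M_col(s)` and `N_col(s) ≤ β₀·(M_col(s) − g)`
(`M` = the `T = 0` margin, `N = aπ₁ + bπ₂ + β_{h,1}aF₁ + β_{h,2}bL` — both affine in `U`, so the columns suffice). Conclusion, through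
`mul_gap_le_mul_sub_chemPot_of_equilibria_hotAnchors_threshold_ttPrime` (`Literature/…/HubbardTTPrimePhaseCoexistenceExclusionGrandCanonical`, g22):
at every `(s, U)` of the cell and every `β ≥ β₀`, between any `μ₁` carrying a translation-invariant variational equilibrium of `H(t,s,U) − μ₁N`
(any `Γ₁` with `e_{Γ₁} = e_Φ − μ₁ρ`) of density `≤ n₁` and any `μ₂` carrying one of density `≥ n₂`: `a·b·(n₂ − n₁)·(μ₂ − μ₁) ≥ g`.
* `psGCT_gap_on_cell_of_fns_hotAnchor` (bound functions), `psGCT_gap_on_cell_of_columns_hotAnchor` (column × threshold form),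
  `psGCT_gap_above_column_hotAnchor` (cap non-decreasing in `U`, one law, far-end checks).
Cell `pub/hubbard-downfold` (MO-S1 ↔ S2 seam «box ↦ one word», filling direction = Legendre pair `μ ↔ n`; D-0096 (ii)/(iii), the `T` axis of
the D-0098 map), seat `hubbard-downfold-unc-2` (g23). Instances: `Downfold/BoxesLa214V115M2cPhaseSeparationGrandCanonicalThermalGap.lean`.
NOT said: anything outside the cells; an ESTIMATE of `μ(β, n)` (the gap is a floor); stripes / SC / `T_c`.
References: [cite: Israel1979, Thm. I.2.4]; [cite: Ruelle1969, §3.4]; [cite: Griffiths1966, §II]; [cite: PoulinHastings2011, eqs. (3)–(8)].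
-/

noncomputable section

namespace Summit.Ventures.CertifiedManyBodySolver.Observables

open Literature.MathematicalPhysics.QuantumLattice Literature.MathematicalPhysics.QuantumLattice.ThermodynamicLimit
open Literature.MathematicalPhysics.QuantumLattice.InfVolFermionState Set Filter

/-- The `T = 0` margin with the `U`-chord floor is the `U`-chord of the two column margins (everything is affine in `U`). [folklore] -/
private theorem marginT_uchord_identity {a b c₀ c₁ U₁ U₂ U F L₁ L₂ : ℝ} (h12 : U₁ < U₂) :
    a * F + b * (((U₂ - U) * L₁ + (U - U₁) * L₂) / (U₂ - U₁)) - (c₀ + c₁ * U) =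
      ((U₂ - U) * (a * F + b * L₁ - (c₀ + c₁ * U₁)) + (U - U₁) * (a * F + b * L₂ - (c₀ + c₁ * U₂))) / (U₂ - U₁) := by
  have hd : (U₂ - U₁) ≠ 0 := (sub_pos.2 h12).ne'
  field_simp
  ring

/-- The anchored threshold slack is affine in `U` through the `U`-chord floor: its value at `U` is the `U`-chord of the two column slacks. [folklore] -/
private theorem slack_uchord_identity {a b c₀ c₁ U₁ U₂ U F L₁ L₂ β₀ βh₁ βh₂ π₁ π₂ g : ℝ} (h12 : U₁ < U₂) :
    β₀ * (a * F + b * (((U₂ - U) * L₁ + (U - U₁) * L₂) / (U₂ - U₁)) - (c₀ + c₁ * U) - g) -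
        (a * π₁ + b * π₂ + βh₁ * (a * F) + βh₂ * (b * (((U₂ - U) * L₁ + (U - U₁) * L₂) / (U₂ - U₁)))) =
      ((U₂ - U) * (β₀ * (a * F + b * L₁ - (c₀ + c₁ * U₁) - g) - (a * π₁ + b * π₂ + βh₁ * (a * F) + βh₂ * (b * L₁))) +
        (U - U₁) * (β₀ * (a * F + b * L₂ - (c₀ + c₁ * U₂) - g) - (a * π₁ + b * π₂ + βh₁ * (a * F) + βh₂ * (b * L₂)))) /
        (U₂ - U₁) := by
  have hd : (U₂ - U₁) ≠ 0 := (sub_pos.2 h12).ne'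
  field_simp
  ring

/-! ## §1 `T > 0`: the CELL-UNIFORM CHEMICAL-POTENTIAL GAP for every `β ≥ β₀` (hot anchors, threshold form) -/

/-- **CELL-UNIFORM GAP at `T > 0` from bound functions and HOT ANCHORS (threshold form).** Cell `[s₁, s₂] × [U₁, U₂]` (`U₁ ≥ 0`),
`0 < n₁ < n₂ < 2`, weights `a, b ≥ 0`, `a + b = 1`; cap / floor functions `C, F₁, F₂` on the ground-state energy density, cell-uniform pressure
ceilings `p(β_{h,i}; t,s,U; n_i) ≤ π_i` at `0 ≤ β_{h,i} ≤ β₀`; a number `g` with, on the cell, `g ≤ aF₁ + bF₂ − C` and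
`aπ₁ + bπ₂ + β_{h,1}aF₁ + β_{h,2}bF₂ ≤ β₀·(aF₁ + bF₂ − C − g)`. Then at every `(s, U)` of the cell and every `β ≥ β₀`: if `μ₁` carries a
variational equilibrium of `H(t,s,U) − μ₁N` (any `Γ₁` with `e_{Γ₁} = e_Φ − μ₁ρ`) of density `≤ n₁` and `μ₂` one of density `≥ n₂`, then
`a·b·(n₂ − n₁)·(μ₂ − μ₁) ≥ g`. [cite: Israel1979, Thm. I.2.4] [cite: PoulinHastings2011, eqs. (3)–(8)] -/
theorem psGCT_gap_on_cell_of_fns_hotAnchor (t : ℝ) {s₁ s₂ U₁ U₂ n₁ n₂ a b β₀ βh₁ βh₂ π₁ π₂ g : ℝ} (hU₁ : 0 ≤ U₁)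
    (hβ₀pos : 0 < β₀) (hn₁ : 0 < n₁) (hn : n₁ < n₂) (hn₂ : n₂ < 2) (ha : 0 ≤ a) (hb : 0 ≤ b) (hab : a + b = 1)
    (hβh₁ : 0 ≤ βh₁) (hβh₂ : 0 ≤ βh₂) (h0₁ : βh₁ ≤ β₀) (h0₂ : βh₂ ≤ β₀) {C F₁ F₂ : ℝ → ℝ → ℝ}
    (hC : ∀ s ∈ Icc s₁ s₂, ∀ U ∈ Icc U₁ U₂, energyDensityTT' t s U (a * n₁ + b * n₂) ≤ C s U)
    (hF₁ : ∀ s ∈ Icc s₁ s₂, ∀ U ∈ Icc U₁ U₂, F₁ s U ≤ energyDensityTT' t s U n₁)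
    (hF₂ : ∀ s ∈ Icc s₁ s₂, ∀ U ∈ Icc U₁ U₂, F₂ s U ≤ energyDensityTT' t s U n₂)
    (hπ₁ : ∀ s ∈ Icc s₁ s₂, ∀ U ∈ Icc U₁ U₂, pressureTT' βh₁ t s U n₁ ≤ π₁)
    (hπ₂ : ∀ s ∈ Icc s₁ s₂, ∀ U ∈ Icc U₁ U₂, pressureTT' βh₂ t s U n₂ ≤ π₂)
    (hgM : ∀ s ∈ Icc s₁ s₂, ∀ U ∈ Icc U₁ U₂, g ≤ a * F₁ s U + b * F₂ s U - C s U)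
    (hN : ∀ s ∈ Icc s₁ s₂, ∀ U ∈ Icc U₁ U₂,
      a * π₁ + b * π₂ + βh₁ * (a * F₁ s U) + βh₂ * (b * F₂ s U) ≤ β₀ * (a * F₁ s U + b * F₂ s U - C s U - g))
    {s : ℝ} (hs : s ∈ Icc s₁ s₂) {U : ℝ} (hU : U ∈ Icc U₁ U₂) {β : ℝ} (hβ : β₀ ≤ β)
    {Γ₁ Γ₂ : FermionInteraction 2} {R₁ R₂ μ₁ μ₂ : ℝ} {ω₁ ω₂ : InfVolFermionState 2}
    (hω₁ : ω₁.IsVarEquilibrium β Γ₁ R₁)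
    (hΓ₁ : ∀ σ : InfVolFermionState 2, σ.meanEnergy Γ₁ R₁ = σ.meanEnergy (hubbardTTPrimeFermionInteraction t s U) 1 - μ₁ * σ.density)
    (hω₂ : ω₂.IsVarEquilibrium β Γ₂ R₂)
    (hΓ₂ : ∀ σ : InfVolFermionState 2, σ.meanEnergy Γ₂ R₂ = σ.meanEnergy (hubbardTTPrimeFermionInteraction t s U) 1 - μ₂ * σ.density)
    (hρ₁ : ω₁.density ≤ n₁) (hρ₂ : n₂ ≤ ω₂.density) :
    g ≤ a * b * (n₂ - n₁) * (μ₂ - μ₁) := by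
  have hβpos : 0 < β := hβ₀pos.trans_le hβ
  have h := mul_gap_le_mul_sub_chemPot_of_equilibria_hotAnchors_threshold_ttPrime t s (hU₁.trans hU.1) hβpos hω₁ hΓ₁ hω₂ hΓ₂
    hn₁ hn₂ hρ₁ hn.le hρ₂ ha hb hab (hC s hs U hU) (hF₁ s hs U hU) (hF₂ s hs U hU) hβh₁ hβh₂ h0₁ h0₂ hβ
    (hπ₁ s hs U hU) (hπ₂ s hs U hU) (hgM s hs U hU) (hN s hs U hU)
  have e : a * b * (n₂ - n₁) * (β * (μ₂ - μ₁)) = β * (a * b * (n₂ - n₁) * (μ₂ - μ₁)) := by ring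
  rw [e] at h
  exact le_of_mul_le_mul_left h hβpos

/-- **CELL-UNIFORM GAP at `T > 0`, COLUMN × THRESHOLD FORM.** Cap affine in `U` (`e(t,s,U, an₁+bn₂) ≤ c₀ + c₁U`), two COLUMN LAWS
`L_i(s) ≤ e(t, s, U_i, n₂)` (their `U`-chord floors the cell), a dilute floor `F₁(s) ≤ e(t, s, U, n₁)` on the cell, cell-uniform anchors
`p(β_{h,i}; n_i) ≤ π_i` (`β_{h,i} ≤ β₀`), and on BOTH columns, for every `s`: `g ≤ aF₁(s) + bL_i(s) − (c₀ + c₁U_i)` and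
`aπ₁ + bπ₂ + β_{h,1}aF₁(s) + β_{h,2}bL_i(s) ≤ β₀·(aF₁(s) + bL_i(s) − (c₀ + c₁U_i) − g)` (both conditions are affine in `U`, so the columns
suffice). Then for every `(s, U)` of the cell and every `β ≥ β₀`: `a·b·(n₂ − n₁)·(μ₂ − μ₁) ≥ g` between any `μ₁` carrying an equilibrium of
density `≤ n₁` and any `μ₂` carrying one of density `≥ n₂`. [cite: Israel1979, Thm. I.2.4] [cite: Ruelle1969, §3.4] [cite: PoulinHastings2011, eqs. (3)–(8)] -/
theorem psGCT_gap_on_cell_of_columns_hotAnchor (t : ℝ) {s₁ s₂ U₁ U₂ n₁ n₂ a b c₀ c₁ β₀ βh₁ βh₂ π₁ π₂ g : ℝ}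
    (hU₁ : 0 ≤ U₁) (h12 : U₁ < U₂) (hn₁ : 0 < n₁) (hn : n₁ < n₂) (hn₂ : n₂ < 2) (ha : 0 ≤ a) (hb : 0 ≤ b)
    (hab : a + b = 1) (hβh₁ : 0 ≤ βh₁) (hβh₂ : 0 ≤ βh₂) (h0₁ : βh₁ ≤ β₀) (h0₂ : βh₂ ≤ β₀) (hβ₀pos : 0 < β₀) {L₁ L₂ F₁ : ℝ → ℝ}
    (hC : ∀ s ∈ Icc s₁ s₂, ∀ U ∈ Icc U₁ U₂, energyDensityTT' t s U (a * n₁ + b * n₂) ≤ c₀ + c₁ * U)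
    (hL₁ : ∀ s ∈ Icc s₁ s₂, L₁ s ≤ energyDensityTT' t s U₁ n₂) (hL₂ : ∀ s ∈ Icc s₁ s₂, L₂ s ≤ energyDensityTT' t s U₂ n₂)
    (hF₁ : ∀ s ∈ Icc s₁ s₂, ∀ U ∈ Icc U₁ U₂, F₁ s ≤ energyDensityTT' t s U n₁)
    (hπ₁ : ∀ s ∈ Icc s₁ s₂, ∀ U ∈ Icc U₁ U₂, pressureTT' βh₁ t s U n₁ ≤ π₁)
    (hπ₂ : ∀ s ∈ Icc s₁ s₂, ∀ U ∈ Icc U₁ U₂, pressureTT' βh₂ t s U n₂ ≤ π₂)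
    (hgm₁ : ∀ s ∈ Icc s₁ s₂, g ≤ a * F₁ s + b * L₁ s - (c₀ + c₁ * U₁))
    (hgm₂ : ∀ s ∈ Icc s₁ s₂, g ≤ a * F₁ s + b * L₂ s - (c₀ + c₁ * U₂))
    (hN₁ : ∀ s ∈ Icc s₁ s₂,
      a * π₁ + b * π₂ + βh₁ * (a * F₁ s) + βh₂ * (b * L₁ s) ≤ β₀ * (a * F₁ s + b * L₁ s - (c₀ + c₁ * U₁) - g))
    (hN₂ : ∀ s ∈ Icc s₁ s₂,
      a * π₁ + b * π₂ + βh₁ * (a * F₁ s) + βh₂ * (b * L₂ s) ≤ β₀ * (a * F₁ s + b * L₂ s - (c₀ + c₁ * U₂) - g))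
    {s : ℝ} (hs : s ∈ Icc s₁ s₂) {U : ℝ} (hU : U ∈ Icc U₁ U₂) {β : ℝ} (hβ : β₀ ≤ β)
    {Γ₁ Γ₂ : FermionInteraction 2} {R₁ R₂ μ₁ μ₂ : ℝ} {ω₁ ω₂ : InfVolFermionState 2}
    (hω₁ : ω₁.IsVarEquilibrium β Γ₁ R₁)
    (hΓ₁ : ∀ σ : InfVolFermionState 2, σ.meanEnergy Γ₁ R₁ = σ.meanEnergy (hubbardTTPrimeFermionInteraction t s U) 1 - μ₁ * σ.density)
    (hω₂ : ω₂.IsVarEquilibrium β Γ₂ R₂)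
    (hΓ₂ : ∀ σ : InfVolFermionState 2, σ.meanEnergy Γ₂ R₂ = σ.meanEnergy (hubbardTTPrimeFermionInteraction t s U) 1 - μ₂ * σ.density)
    (hρ₁ : ω₁.density ≤ n₁) (hρ₂ : n₂ ≤ ω₂.density) :
    g ≤ a * b * (n₂ - n₁) * (μ₂ - μ₁) := by
  have hn2' : 0 ≤ n₂ := hn₁.le.trans hn.le
  refine psGCT_gap_on_cell_of_fns_hotAnchor t hU₁ hβ₀pos hn₁ hn hn₂ ha hb hab hβh₁ hβh₂ h0₁ h0₂
    (C := fun _ U => c₀ + c₁ * U) (F₁ := fun s _ => F₁ s)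
    (F₂ := fun s U => ((U₂ - U) * L₁ s + (U - U₁) * L₂ s) / (U₂ - U₁)) hC hF₁
    (floor_on_cell_of_columnLaws t hn2' hn₂ hU₁ h12 hL₁ hL₂) hπ₁ hπ₂ ?_ ?_ hs hU hβ hω₁ hΓ₁ hω₂ hΓ₂ hρ₁ hρ₂
  · intro s hs U hU
    have hge := chord_ge_of_ends_ge h12 hU (hgm₁ s hs) (hgm₂ s hs)
    have hidM := marginT_uchord_identity (a := a) (b := b) (c₀ := c₀) (c₁ := c₁) (U := U) (F := F₁ s) (L₁ := L₁ s) (L₂ := L₂ s) h12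
    show g ≤ a * F₁ s + b * (((U₂ - U) * L₁ s + (U - U₁) * L₂ s) / (U₂ - U₁)) - (c₀ + c₁ * U)
    rw [hidM]
    exact hge
  · intro s hs U hU
    have e₁ : 0 ≤ β₀ * (a * F₁ s + b * L₁ s - (c₀ + c₁ * U₁) - g) - (a * π₁ + b * π₂ + βh₁ * (a * F₁ s) + βh₂ * (b * L₁ s)) := by
      have := hN₁ s hs; linarith
    have e₂ : 0 ≤ β₀ * (a * F₁ s + b * L₂ s - (c₀ + c₁ * U₂) - g) - (a * π₁ + b * π₂ + βh₁ * (a * F₁ s) + βh₂ * (b * L₂ s)) := by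
      have := hN₂ s hs; linarith
    have hchord := chord_ge_of_ends_ge h12 hU e₁ e₂
    have hid := slack_uchord_identity (a := a) (b := b) (c₀ := c₀) (c₁ := c₁) (U := U) (F := F₁ s) (L₁ := L₁ s) (L₂ := L₂ s)
      (β₀ := β₀) (βh₁ := βh₁) (βh₂ := βh₂) (π₁ := π₁) (π₂ := π₂) (g := g) h12
    rw [← hid] at hchord
    show a * π₁ + b * π₂ + βh₁ * (a * F₁ s) + βh₂ * (b * (((U₂ - U) * L₁ s + (U - U₁) * L₂ s) / (U₂ - U₁))) ≤
      β₀ * (a * F₁ s + b * (((U₂ - U) * L₁ s + (U - U₁) * L₂ s) / (U₂ - U₁)) - (c₀ + c₁ * U) - g)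
    linarith

/-- **CELL-UNIFORM GAP at `T > 0` ABOVE A COLUMN (threshold form).** Cap with `c₁ ≥ 0`, ONE column law `L(s) ≤ e(t, s, U₂, n₂)` (floors
every `U ≥ U₂`), dilute floor, cell-uniform anchors, and at the FAR end `U₃`, for every `s`: `g ≤ aF₁(s) + bL(s) − (c₀ + c₁U₃)` and
`aπ₁ + bπ₂ + β_{h,1}aF₁(s) + β_{h,2}bL(s) ≤ β₀·(aF₁(s) + bL(s) − (c₀ + c₁U₃) − g)`. Then on `[s₁, s₂] × [U₂, U₃]`, for every `β ≥ β₀`: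
`a·b·(n₂ − n₁)·(μ₂ − μ₁) ≥ g`. [cite: Israel1979, Thm. I.2.4] [cite: Griffiths1966, §II] [cite: PoulinHastings2011, eqs. (3)–(8)] -/
theorem psGCT_gap_above_column_hotAnchor (t : ℝ) {s₁ s₂ U₂ U₃ n₁ n₂ a b c₀ c₁ β₀ βh₁ βh₂ π₁ π₂ g : ℝ}
    (hU₂ : 0 ≤ U₂) (hc₁ : 0 ≤ c₁) (hn₁ : 0 < n₁) (hn : n₁ < n₂) (hn₂ : n₂ < 2) (ha : 0 ≤ a) (hb : 0 ≤ b)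
    (hab : a + b = 1) (hβh₁ : 0 ≤ βh₁) (hβh₂ : 0 ≤ βh₂) (h0₁ : βh₁ ≤ β₀) (h0₂ : βh₂ ≤ β₀) (hβ₀pos : 0 < β₀)
    {L F₁ : ℝ → ℝ}
    (hC : ∀ s ∈ Icc s₁ s₂, ∀ U ∈ Icc U₂ U₃, energyDensityTT' t s U (a * n₁ + b * n₂) ≤ c₀ + c₁ * U)
    (hL : ∀ s ∈ Icc s₁ s₂, L s ≤ energyDensityTT' t s U₂ n₂)
    (hF₁ : ∀ s ∈ Icc s₁ s₂, ∀ U ∈ Icc U₂ U₃, F₁ s ≤ energyDensityTT' t s U n₁)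
    (hπ₁ : ∀ s ∈ Icc s₁ s₂, ∀ U ∈ Icc U₂ U₃, pressureTT' βh₁ t s U n₁ ≤ π₁)
    (hπ₂ : ∀ s ∈ Icc s₁ s₂, ∀ U ∈ Icc U₂ U₃, pressureTT' βh₂ t s U n₂ ≤ π₂)
    (hgm : ∀ s ∈ Icc s₁ s₂, g ≤ a * F₁ s + b * L s - (c₀ + c₁ * U₃))
    (hN : ∀ s ∈ Icc s₁ s₂,
      a * π₁ + b * π₂ + βh₁ * (a * F₁ s) + βh₂ * (b * L s) ≤ β₀ * (a * F₁ s + b * L s - (c₀ + c₁ * U₃) - g))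
    {s : ℝ} (hs : s ∈ Icc s₁ s₂) {U : ℝ} (hU : U ∈ Icc U₂ U₃) {β : ℝ} (hβ : β₀ ≤ β)
    {Γ₁ Γ₂ : FermionInteraction 2} {R₁ R₂ μ₁ μ₂ : ℝ} {ω₁ ω₂ : InfVolFermionState 2}
    (hω₁ : ω₁.IsVarEquilibrium β Γ₁ R₁)
    (hΓ₁ : ∀ σ : InfVolFermionState 2, σ.meanEnergy Γ₁ R₁ = σ.meanEnergy (hubbardTTPrimeFermionInteraction t s U) 1 - μ₁ * σ.density)
    (hω₂ : ω₂.IsVarEquilibrium β Γ₂ R₂)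
    (hΓ₂ : ∀ σ : InfVolFermionState 2, σ.meanEnergy Γ₂ R₂ = σ.meanEnergy (hubbardTTPrimeFermionInteraction t s U) 1 - μ₂ * σ.density)
    (hρ₁ : ω₁.density ≤ n₁) (hρ₂ : n₂ ≤ ω₂.density) :
    g ≤ a * b * (n₂ - n₁) * (μ₂ - μ₁) := by
  have hn2' : 0 ≤ n₂ := hn₁.le.trans hn.le
  refine psGCT_gap_on_cell_of_fns_hotAnchor t hU₂ hβ₀pos hn₁ hn hn₂ ha hb hab hβh₁ hβh₂ h0₁ h0₂
    (C := fun _ U => c₀ + c₁ * U) (F₁ := fun s _ => F₁ s) (F₂ := fun s _ => L s) hC hF₁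
    (fun s hs U hU => floor_above_column_of_law t hn2' hn₂ hU₂ hL s hs U hU.1) hπ₁ hπ₂ ?_ ?_ hs hU hβ hω₁ hΓ₁ hω₂ hΓ₂ hρ₁ hρ₂
  · intro s hs U hU
    have k := mul_le_mul_of_nonneg_left hU.2 hc₁
    have h := hgm s hs
    show g ≤ a * F₁ s + b * L s - (c₀ + c₁ * U)
    linarith
  · intro s hs U hU
    have k := mul_le_mul_of_nonneg_left hU.2 hc₁
    have hg3 := hgm s hs
    have hM : a * F₁ s + b * L s - (c₀ + c₁ * U₃) - g ≤ a * F₁ s + b * L s - (c₀ + c₁ * U) - g := by linarith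
    have k1 := mul_le_mul_of_nonneg_left hM hβ₀pos.le
    have hN' := hN s hs
    show a * π₁ + b * π₂ + βh₁ * (a * F₁ s) + βh₂ * (b * L s) ≤ β₀ * (a * F₁ s + b * L s - (c₀ + c₁ * U) - g)
    linarith


/-! ## §4 `s`/`U`-DEPENDENT anchored ceilings (g24 append): the `T > 0` gap law with anchor FUNCTIONS, and the above-column form with `Q₂(s)` -/

/-- **CELL-UNIFORM GAP at `T > 0` from bound functions, `s`/`U`-DEPENDENT ANCHORS.** As `psGCT_gap_on_cell_of_fns_hotAnchor`, but the pressure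
ceilings at the outer densities are FUNCTIONS `P₁(s, U)`, `P₂(s, U)` on the cell (e.g. `t′`-chords of two equal-`β_h` anchors,
`pressureTT'_le_schord_of_anchors`). [cite: Israel1979, Thm. I.2.4] [cite: Ruelle1969, §3.4] [cite: PoulinHastings2011, eqs. (3)–(8)] -/
theorem psGCT_gap_on_cell_of_fns_hotAnchorFn (t : ℝ) {s₁ s₂ U₁ U₂ n₁ n₂ a b β₀ βh₁ βh₂ g : ℝ} (hU₁ : 0 ≤ U₁)
    (hβ₀pos : 0 < β₀) (hn₁ : 0 < n₁) (hn : n₁ < n₂) (hn₂ : n₂ < 2) (ha : 0 ≤ a) (hb : 0 ≤ b) (hab : a + b = 1)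
    (hβh₁ : 0 ≤ βh₁) (hβh₂ : 0 ≤ βh₂) (h0₁ : βh₁ ≤ β₀) (h0₂ : βh₂ ≤ β₀) {C F₁ F₂ P₁ P₂ : ℝ → ℝ → ℝ}
    (hC : ∀ s ∈ Icc s₁ s₂, ∀ U ∈ Icc U₁ U₂, energyDensityTT' t s U (a * n₁ + b * n₂) ≤ C s U)
    (hF₁ : ∀ s ∈ Icc s₁ s₂, ∀ U ∈ Icc U₁ U₂, F₁ s U ≤ energyDensityTT' t s U n₁)
    (hF₂ : ∀ s ∈ Icc s₁ s₂, ∀ U ∈ Icc U₁ U₂, F₂ s U ≤ energyDensityTT' t s U n₂)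
    (hπ₁ : ∀ s ∈ Icc s₁ s₂, ∀ U ∈ Icc U₁ U₂, pressureTT' βh₁ t s U n₁ ≤ P₁ s U)
    (hπ₂ : ∀ s ∈ Icc s₁ s₂, ∀ U ∈ Icc U₁ U₂, pressureTT' βh₂ t s U n₂ ≤ P₂ s U)
    (hgM : ∀ s ∈ Icc s₁ s₂, ∀ U ∈ Icc U₁ U₂, g ≤ a * F₁ s U + b * F₂ s U - C s U)
    (hN : ∀ s ∈ Icc s₁ s₂, ∀ U ∈ Icc U₁ U₂,
      a * P₁ s U + b * P₂ s U + βh₁ * (a * F₁ s U) + βh₂ * (b * F₂ s U) ≤ β₀ * (a * F₁ s U + b * F₂ s U - C s U - g))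
    {s : ℝ} (hs : s ∈ Icc s₁ s₂) {U : ℝ} (hU : U ∈ Icc U₁ U₂) {β : ℝ} (hβ : β₀ ≤ β)
    {Γ₁ Γ₂ : FermionInteraction 2} {R₁ R₂ μ₁ μ₂ : ℝ} {ω₁ ω₂ : InfVolFermionState 2}
    (hω₁ : ω₁.IsVarEquilibrium β Γ₁ R₁)
    (hΓ₁ : ∀ σ : InfVolFermionState 2, σ.meanEnergy Γ₁ R₁ = σ.meanEnergy (hubbardTTPrimeFermionInteraction t s U) 1 - μ₁ * σ.density)
    (hω₂ : ω₂.IsVarEquilibrium β Γ₂ R₂)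
    (hΓ₂ : ∀ σ : InfVolFermionState 2, σ.meanEnergy Γ₂ R₂ = σ.meanEnergy (hubbardTTPrimeFermionInteraction t s U) 1 - μ₂ * σ.density)
    (hρ₁ : ω₁.density ≤ n₁) (hρ₂ : n₂ ≤ ω₂.density) :
    g ≤ a * b * (n₂ - n₁) * (μ₂ - μ₁) := by
  have hβpos : 0 < β := hβ₀pos.trans_le hβ
  have h := mul_gap_le_mul_sub_chemPot_of_equilibria_hotAnchors_threshold_ttPrime t s (hU₁.trans hU.1) hβpos hω₁ hΓ₁ hω₂ hΓ₂
    hn₁ hn₂ hρ₁ hn.le hρ₂ ha hb hab (hC s hs U hU) (hF₁ s hs U hU) (hF₂ s hs U hU) hβh₁ hβh₂ h0₁ h0₂ hβ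
    (hπ₁ s hs U hU) (hπ₂ s hs U hU) (hgM s hs U hU) (hN s hs U hU)
  have e : a * b * (n₂ - n₁) * (β * (μ₂ - μ₁)) = β * (a * b * (n₂ - n₁) * (μ₂ - μ₁)) := by ring
  rw [e] at h
  exact le_of_mul_le_mul_left h hβpos

/-- **CELL-UNIFORM GAP at `T > 0` ABOVE A COLUMN with an `s`-DEPENDENT `n₂`-ANCHOR `Q₂(s)`**: as `psGCT_gap_above_column_hotAnchor` with `b·π₂`
replaced by `b·Q₂(s)` (e.g. the `t′`-chord of two equal-`β_h` anchors; for `Q₂` affine in `s` the two conditions are checked at the `s`-ends).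
[cite: Israel1979, Thm. I.2.4] [cite: Ruelle1969, §3.4] [cite: Griffiths1966, §II] [cite: PoulinHastings2011, eqs. (3)–(8)] -/
theorem psGCT_gap_above_column_hotAnchorS (t : ℝ) {s₁ s₂ U₂ U₃ n₁ n₂ a b c₀ c₁ β₀ βh₁ βh₂ π₁ g : ℝ}
    (hU₂ : 0 ≤ U₂) (hc₁ : 0 ≤ c₁) (hn₁ : 0 < n₁) (hn : n₁ < n₂) (hn₂ : n₂ < 2) (ha : 0 ≤ a) (hb : 0 ≤ b)
    (hab : a + b = 1) (hβh₁ : 0 ≤ βh₁) (hβh₂ : 0 ≤ βh₂) (h0₁ : βh₁ ≤ β₀) (h0₂ : βh₂ ≤ β₀) (hβ₀pos : 0 < β₀)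
    {L F₁ Q₂ : ℝ → ℝ}
    (hC : ∀ s ∈ Icc s₁ s₂, ∀ U ∈ Icc U₂ U₃, energyDensityTT' t s U (a * n₁ + b * n₂) ≤ c₀ + c₁ * U)
    (hL : ∀ s ∈ Icc s₁ s₂, L s ≤ energyDensityTT' t s U₂ n₂)
    (hF₁ : ∀ s ∈ Icc s₁ s₂, ∀ U ∈ Icc U₂ U₃, F₁ s ≤ energyDensityTT' t s U n₁)
    (hπ₁ : ∀ s ∈ Icc s₁ s₂, ∀ U ∈ Icc U₂ U₃, pressureTT' βh₁ t s U n₁ ≤ π₁)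
    (hπ₂ : ∀ s ∈ Icc s₁ s₂, ∀ U ∈ Icc U₂ U₃, pressureTT' βh₂ t s U n₂ ≤ Q₂ s)
    (hgm : ∀ s ∈ Icc s₁ s₂, g ≤ a * F₁ s + b * L s - (c₀ + c₁ * U₃))
    (hN : ∀ s ∈ Icc s₁ s₂,
      a * π₁ + b * Q₂ s + βh₁ * (a * F₁ s) + βh₂ * (b * L s) ≤ β₀ * (a * F₁ s + b * L s - (c₀ + c₁ * U₃) - g))
    {s : ℝ} (hs : s ∈ Icc s₁ s₂) {U : ℝ} (hU : U ∈ Icc U₂ U₃) {β : ℝ} (hβ : β₀ ≤ β)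
    {Γ₁ Γ₂ : FermionInteraction 2} {R₁ R₂ μ₁ μ₂ : ℝ} {ω₁ ω₂ : InfVolFermionState 2}
    (hω₁ : ω₁.IsVarEquilibrium β Γ₁ R₁)
    (hΓ₁ : ∀ σ : InfVolFermionState 2, σ.meanEnergy Γ₁ R₁ = σ.meanEnergy (hubbardTTPrimeFermionInteraction t s U) 1 - μ₁ * σ.density)
    (hω₂ : ω₂.IsVarEquilibrium β Γ₂ R₂)
    (hΓ₂ : ∀ σ : InfVolFermionState 2, σ.meanEnergy Γ₂ R₂ = σ.meanEnergy (hubbardTTPrimeFermionInteraction t s U) 1 - μ₂ * σ.density)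
    (hρ₁ : ω₁.density ≤ n₁) (hρ₂ : n₂ ≤ ω₂.density) :
    g ≤ a * b * (n₂ - n₁) * (μ₂ - μ₁) := by
  have hn2' : 0 ≤ n₂ := hn₁.le.trans hn.le
  refine psGCT_gap_on_cell_of_fns_hotAnchorFn t hU₂ hβ₀pos hn₁ hn hn₂ ha hb hab hβh₁ hβh₂ h0₁ h0₂
    (C := fun _ U => c₀ + c₁ * U) (F₁ := fun s _ => F₁ s) (F₂ := fun s _ => L s) (P₁ := fun _ _ => π₁) (P₂ := fun s _ => Q₂ s) hC hF₁
    (fun s hs U hU => floor_above_column_of_law t hn2' hn₂ hU₂ hL s hs U hU.1) hπ₁ hπ₂ ?_ ?_ hs hU hβ hω₁ hΓ₁ hω₂ hΓ₂ hρ₁ hρ₂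
  · intro s hs U hU
    have k := mul_le_mul_of_nonneg_left hU.2 hc₁
    have h := hgm s hs
    show g ≤ a * F₁ s + b * L s - (c₀ + c₁ * U)
    linarith
  · intro s hs U hU
    have k := mul_le_mul_of_nonneg_left hU.2 hc₁
    have hg3 := hgm s hs
    have hM : a * F₁ s + b * L s - (c₀ + c₁ * U₃) - g ≤ a * F₁ s + b * L s - (c₀ + c₁ * U) - g := by linarith
    have k1 := mul_le_mul_of_nonneg_left hM hβ₀pos.le
    have hN' := hN s hs
    show a * π₁ + b * Q₂ s + βh₁ * (a * F₁ s) + βh₂ * (b * L s) ≤ β₀ * (a * F₁ s + b * L s - (c₀ + c₁ * U) - g)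
    linarith

end Summit.Ventures.CertifiedManyBodySolver.Observables

end
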